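import Mathlib
import Summits.NavierStokesRegularity.NavierStokesRegularity.Theorems.EulerZoomLiouvillePowerGaugeEulerLiouvilleWindowFluxBoundsSplit
import Summits.NavierStokesRegularity.NavierStokesRegularity.Theorems.EulerZoomLiouvillePowerGaugeEulerLiouvilleEnergyEscape
import Summits.NavierStokesRegularity.NavierStokesRegularity.Theorems.EulerZoomLiouvillePowerGaugeEulerLiouvilleEnergyMonotone
import HarnessLib

/-!
# Window flux integrability and the flux strata of the open core for `2/9 < ρ` (was: `2/5 < ρ`)
# (crux `EulerZoomLiouville.PowerGaugeEulerLiouville` = stmt-NavierStokesRegularity-19832, lead's line `birth`)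

Route `EulerZoomLiouville` (NavierStokesRegularity).  Last brick of the sharper pressure route
(`…PressureSplitSlice` → `…PressureSplitWindow` → `…WindowFluxBoundsSplit` → here).  With the one-ball flux mass at
the cubic rate `a^{3/2−9ρ/4}` (`exists_oneBall_window_le_split`: the pressure handled by the LOCAL PRESSURE SPLITTING
and the tree's proved Calderón–Zygmund bound, instead of Hölder with the `D`-gauge), the dyadic-shell summation of
`…WindowFlux.lean` converges as soon as `2^{1/2 − 9ρ/4} < 1`, i.e. for `ρ > 2/9`:

* `windowFlux_integrableOn_of_gauge_twoNinths` — for a member with `2/9 < ρ`, the weighted Euler flux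
  `(|u|³ + 2|p||u|)/max(1,|x|)` is integrable on every finite window `(α,β) × ℝ³`, `α < β < 0`.

Hence EVERY flux stratum of the open core `stub_noCollapseFromZero` now holds UNCONDITIONALLY on `2/9 < ρ` (the
previous files had `2/5 < ρ`), the crux's hypotheses VERBATIM plus one extra hypothesis each:
* `powerGaugeEulerLiouville_fromRest_twoNinths` — «no Euler collapse from rest»;
* `powerGaugeEulerLiouville_of_energyVanishing_twoNinths` — «no Euler collapse from an energy-quiescent past»;
* `powerGaugeEulerLiouville_of_tightPast_twoNinths` — «no backward-tight nontrivial member» (backward energy escape);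
* `powerGauge_energy_antitone_ae_twoNinths` — the global (Leray) energy inequality of the class.

The threshold `2/9` is now set by the CUBIC flux `|u|³` alone (slice-wise Sobolev interpolation with the `A`- and
`E`-gauges, `a^{3/2−9ρ/4}` on the ball `B_a`); the window `(0, 2/9]` is what remains for these strata.  WHAT THIS IS
NOT: not NS regularity, not the open core (members whose energy is present at `t = −∞` — the self-similar/DSS
candidates of the Chae–Shvydkoy window — are untouched); kernel-checked in-window strata `--supports` stmt-19832.
[folklore]
-/

noncomputable section

set_option linter.dupNamespace false

open MeasureTheory Set Filter Topology Metric Function TopologicalSpace Module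
open scoped ENNReal NNReal

namespace Summit.NavierStokesRegularity.NavierStokesRegularity.Theorems.PowerGaugeEulerLiouville

open Literature.Analysis Literature.Analysis.FunctionSpaces Literature.Analysis.FluidPDE

/-! ## Window flux integrability for `2/9 < ρ` -/

/-- **The weighted Euler flux of a member is integrable on finite windows when `2/9 < ρ`.**  For a member of
Seregin's power-gauged class with `2/9 < ρ` and every window `α < β < 0`:
`∫_{(α,β)×ℝ³} (|u|³ + 2|p||u|)/max(1,|x|) < ∞` — dyadic shells `a₀2ʲ ≤ |x| < a₀2^{j+1}` (`a₀ ≥ 1`, `a₀² ≥ −α`), the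
one-ball bound `exists_oneBall_window_le_split` (pressure splitting, cubic rate) and the geometric series with
ratio `2^{1/2 − 9ρ/4} < 1`.  Verbatim the summation of `windowFlux_integrableOn_of_gauge`. [folklore] -/
theorem windowFlux_integrableOn_of_gauge_twoNinths {ρ : ℝ} (hρ : 2 / 9 < ρ)
    {u : ℝ → EuclideanSpace ℝ (Fin 3) → EuclideanSpace ℝ (Fin 3)} {p : ℝ → EuclideanSpace ℝ (Fin 3) → ℝ}
    {H : ℝ → EuclideanSpace ℝ (Fin 3) → EuclideanSpace ℝ (Fin 3) →L[ℝ] EuclideanSpace ℝ (Fin 3)} {c : ℝ≥0}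
    (hsw : IsSuitableWeakSolutionOn (slab (EuclideanSpace ℝ (Fin 3)) (Iio 0) isOpen_Iio) 0 0 u p)
    (hH : HasWeakSpatialGradientOn (slab (EuclideanSpace ℝ (Fin 3)) (Iio 0) isOpen_Iio) u H)
    (hc : ∀ a : ℝ, 0 < a → ENNReal.ofReal (a ^ (2 * ρ)) * cknA a (0 : ℝ × EuclideanSpace ℝ (Fin 3)) u +
        ENNReal.ofReal (a ^ ρ) * cknE a (0 : ℝ × EuclideanSpace ℝ (Fin 3)) H +
        ENNReal.ofReal (a ^ (2 * ρ)) * cknD a (0 : ℝ × EuclideanSpace ℝ (Fin 3)) p ≤ (c : ℝ≥0∞))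
    {α β : ℝ} (hαβ : α < β) (hβ : β < 0) :
    IntegrableOn
      (fun z : ℝ × EuclideanSpace ℝ (Fin 3) => (‖u z.1 z.2‖ ^ 3 + 2 * |p z.1 z.2| * ‖u z.1 z.2‖) / max 1 ‖z.2‖)
      (Ioo α β ×ˢ (univ : Set (EuclideanSpace ℝ (Fin 3)))) volume := by
  have hρ0 : 0 ≤ ρ := by linarith
  obtain ⟨M, hM0, hM⟩ := exists_oneBall_window_le_split hρ0 hsw hH hc hαβ hβ.le
  set W : Set ℝ := Ioo α β with hW
  have hWs : W ⊆ Iio 0 := fun s hs => lt_trans hs.2 hβ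
  -- measurability on the slab
  have hum : AEStronglyMeasurable (uncurry u)
      (volume.restrict (Iio (0 : ℝ) ×ˢ (univ : Set (EuclideanSpace ℝ (Fin 3))))) := by
    have := hH.locallyIntegrableOn.aestronglyMeasurable
    simpa [slab] using this
  have hpm : AEStronglyMeasurable (uncurry p)
      (volume.restrict (Iio (0 : ℝ) ×ˢ (univ : Set (EuclideanSpace ℝ (Fin 3))))) := by
    have := hsw.distributional.2.2.1.aestronglyMeasurable
    simpa [slab] using this
  set μ : Measure (ℝ × EuclideanSpace ℝ (Fin 3)) := volume.restrict (W ×ˢ (univ : Set (EuclideanSpace ℝ (Fin 3)))) with hμ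
  have hum' : AEStronglyMeasurable (uncurry u) μ := hum.mono_measure (Measure.restrict_mono (prod_mono hWs Subset.rfl) le_rfl)
  have hpm' : AEStronglyMeasurable (uncurry p) μ := hpm.mono_measure (Measure.restrict_mono (prod_mono hWs Subset.rfl) le_rfl)
  set G : ℝ × EuclideanSpace ℝ (Fin 3) → ℝ :=
    fun z => (‖u z.1 z.2‖ ^ 3 + 2 * |p z.1 z.2| * ‖u z.1 z.2‖) / max 1 ‖z.2‖ with hG
  have hwcont : Continuous fun z : ℝ × EuclideanSpace ℝ (Fin 3) => (max 1 ‖z.2‖)⁻¹ :=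
    Continuous.inv₀ (continuous_const.max continuous_snd.norm) fun z => (lt_of_lt_of_le one_pos (le_max_left _ _)).ne'
  have hGm : AEStronglyMeasurable G μ := by
    have h1 : AEStronglyMeasurable (fun z : ℝ × EuclideanSpace ℝ (Fin 3) =>
        (‖uncurry u z‖ ^ 3 + 2 * |uncurry p z| * ‖uncurry u z‖) * (max 1 ‖z.2‖)⁻¹) μ :=
      ((hum'.norm.pow 3).add ((hpm'.norm.const_mul 2).mul hum'.norm)).mul hwcont.aestronglyMeasurable
    refine h1.congr (Eventually.of_forall fun z => ?_)
    simp only [hG, uncurry, div_eq_mul_inv]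
  refine ⟨hGm, ?_⟩
  -- the `ℝ≥0∞` density `Ψ ≥ ‖G‖ₑ`
  set Ψ : ℝ × EuclideanSpace ℝ (Fin 3) → ℝ≥0∞ := fun z =>
    (‖u z.1 z.2‖ₑ ^ (3 : ℕ) + 2 * (‖p z.1 z.2‖ₑ * ‖u z.1 z.2‖ₑ)) * (ENNReal.ofReal (max 1 ‖z.2‖))⁻¹ with hΨ
  have hGΨ : ∀ z, ‖G z‖ₑ ≤ Ψ z := by
    intro z
    have hm : 0 < max 1 ‖z.2‖ := lt_of_lt_of_le one_pos (le_max_left _ _)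
    have hG0 : 0 ≤ G z := by simp only [hG]; positivity
    rw [Real.enorm_eq_ofReal hG0, hG, ENNReal.ofReal_div_of_pos hm, div_eq_mul_inv]
    refine mul_le_mul' (le_of_eq ?_) le_rfl
    have e1 : ENNReal.ofReal (‖u z.1 z.2‖ ^ 3) = ‖u z.1 z.2‖ₑ ^ (3 : ℕ) := by
      rw [ENNReal.ofReal_pow (norm_nonneg _), ofReal_norm]
    have e2 : ENNReal.ofReal (2 * |p z.1 z.2| * ‖u z.1 z.2‖) = 2 * (‖p z.1 z.2‖ₑ * ‖u z.1 z.2‖ₑ) := by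
      rw [mul_assoc, ENNReal.ofReal_mul (by norm_num : (0 : ℝ) ≤ 2), ENNReal.ofReal_ofNat,
        ENNReal.ofReal_mul (abs_nonneg _), ← Real.norm_eq_abs, ofReal_norm, ofReal_norm]
    rw [ENNReal.ofReal_add (by positivity) (by positivity), e1, e2]
  -- dyadic radii
  have hα0 : 0 < -α := by linarith
  set a₀ : ℝ := max 1 (Real.sqrt (-α)) with ha₀
  have ha₀1 : 1 ≤ a₀ := le_max_left _ _
  have ha₀0 : 0 < a₀ := lt_of_lt_of_le one_pos ha₀1
  have ha₀α : -(a₀ ^ 2) ≤ α := by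
    have h1 : Real.sqrt (-α) ≤ a₀ := le_max_right _ _
    have h2 : Real.sqrt (-α) ^ 2 = -α := Real.sq_sqrt hα0.le
    nlinarith [Real.sqrt_nonneg (-α)]
  set R : ℕ → ℝ := fun j => a₀ * 2 ^ j with hR
  have hR1 : ∀ j, 1 ≤ R j := fun j => by
    simp only [hR]; exact le_trans ha₀1 (le_mul_of_one_le_right ha₀0.le (one_le_pow₀ (by norm_num)))
  have hR0 : ∀ j, 0 < R j := fun j => lt_of_lt_of_le one_pos (hR1 j)
  have hRα : ∀ j, -(R j ^ 2) ≤ α := fun j => by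
    have : a₀ ^ 2 ≤ R j ^ 2 := by
      have h1 : a₀ ≤ R j := by simp only [hR]; exact le_mul_of_one_le_right ha₀0.le (one_le_pow₀ (by norm_num))
      nlinarith
    linarith
  have hRmono : ∀ j, R j ≤ R (j + 1) := fun j => by
    simp only [hR, pow_succ]; nlinarith [pow_pos (two_pos : (0:ℝ) < 2) j]
  -- the one-ball masses
  set N : ℕ → ℝ≥0∞ := fun j => ∫⁻ z in W ×ˢ ball (0 : EuclideanSpace ℝ (Fin 3)) (R j),
    (‖u z.1 z.2‖ₑ ^ (3 : ℕ) + 2 * (‖p z.1 z.2‖ₑ * ‖u z.1 z.2‖ₑ)) with hN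
  set s₁ : ℝ := 3 / 2 - 9 * ρ / 4 with hs₁
  have hNle : ∀ j, N j ≤ ENNReal.ofReal (M * R j ^ s₁) := fun j => hM (R j) (hR1 j) (hRα j)
  -- shells
  set D : ℕ → Set (EuclideanSpace ℝ (Fin 3)) := fun j =>
    Nat.casesOn j (ball (0 : EuclideanSpace ℝ (Fin 3)) (R 0))
      (fun i => ball (0 : EuclideanSpace ℝ (Fin 3)) (R (i + 1)) \ ball (0 : EuclideanSpace ℝ (Fin 3)) (R i)) with hD
  have hDU : (⋃ j, W ×ˢ D j) = W ×ˢ (univ : Set (EuclideanSpace ℝ (Fin 3))) := by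
    rw [← prod_iUnion]
    congr 1
    refine eq_univ_of_forall fun x => mem_iUnion.2 ?_
    -- the least `j` with `‖x‖ < R j`
    have hex : ∃ j : ℕ, ‖x‖ < R j := by
      obtain ⟨n, hn⟩ := pow_unbounded_of_one_lt ‖x‖ (by norm_num : (1 : ℝ) < 2)
      refine ⟨n, lt_of_lt_of_le hn ?_⟩
      simp only [hR]; exact le_mul_of_one_le_left (by positivity) ha₀1
    classical
    refine ⟨Nat.find hex, ?_⟩
    rcases h : Nat.find hex with _ | i
    · have := Nat.find_spec hex; rw [h] at this; exact mem_ball_zero_iff.2 this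
    · have h1 := Nat.find_spec hex; rw [h] at h1
      have h2 := Nat.find_min hex (show i < Nat.find hex by omega)
      exact ⟨mem_ball_zero_iff.2 h1, fun hx => h2 (mem_ball_zero_iff.1 hx)⟩
  -- shell estimates
  have hshell0 : ∫⁻ z in W ×ˢ D 0, Ψ z ≤ N 0 := by
    refine lintegral_mono fun z => ?_
    simp only [hΨ]
    refine mul_le_of_le_one_right' ?_
    rw [ENNReal.inv_le_one]
    exact ENNReal.one_le_ofReal.2 (le_max_left _ _)
  have hshell : ∀ i : ℕ, ∫⁻ z in W ×ˢ D (i + 1), Ψ z ≤ (ENNReal.ofReal (R i))⁻¹ * N (i + 1) := by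
    intro i
    have hsub : W ×ˢ D (i + 1) ⊆ W ×ˢ ball (0 : EuclideanSpace ℝ (Fin 3)) (R (i + 1)) :=
      prod_mono Subset.rfl sdiff_subset
    calc ∫⁻ z in W ×ˢ D (i + 1), Ψ z
        ≤ ∫⁻ z in W ×ˢ D (i + 1), (ENNReal.ofReal (R i))⁻¹ *
            (‖u z.1 z.2‖ₑ ^ (3 : ℕ) + 2 * (‖p z.1 z.2‖ₑ * ‖u z.1 z.2‖ₑ)) := by
          refine setLIntegral_mono' (measurableSet_Ioo.prod (measurableSet_ball.diff measurableSet_ball)) fun z hz => ?_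
          simp only [hΨ]
          rw [mul_comm]
          refine mul_le_mul' ?_ le_rfl
          rw [ENNReal.inv_le_inv]
          refine ENNReal.ofReal_le_ofReal (le_trans ?_ (le_max_right _ _))
          have := hz.2.2
          rw [mem_ball_zero_iff, not_lt] at this
          exact this
      _ = (ENNReal.ofReal (R i))⁻¹ * ∫⁻ z in W ×ˢ D (i + 1), (‖u z.1 z.2‖ₑ ^ (3 : ℕ) + 2 * (‖p z.1 z.2‖ₑ * ‖u z.1 z.2‖ₑ)) :=
          lintegral_const_mul' _ _ (ENNReal.inv_ne_top.2 ((ENNReal.ofReal_pos.2 (hR0 i)).ne'))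
      _ ≤ (ENNReal.ofReal (R i))⁻¹ * N (i + 1) := mul_le_mul' le_rfl (lintegral_mono_set hsub)
  -- the dyadic terms are a geometric sequence with ratio `2^{s₁ - 1} < 1` (iff `ρ > 2/9`)
  set θ₁ : ℝ := (2 : ℝ) ^ (s₁ - 1) with hθ₁
  have hθ₁1 : θ₁ < 1 := Real.rpow_lt_one_of_one_lt_of_neg (by norm_num) (by rw [hs₁]; linarith)
  have hθ₁0 : 0 ≤ θ₁ := by positivity
  set M₁ : ℝ := M * (2 ^ s₁ * a₀ ^ (s₁ - 1)) with hM₁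
  have hterm : ∀ i : ℕ, (ENNReal.ofReal (R i))⁻¹ * N (i + 1) ≤ ENNReal.ofReal (M₁ * θ₁ ^ i + 0 * (0 : ℝ) ^ i) := by
    intro i
    calc (ENNReal.ofReal (R i))⁻¹ * N (i + 1)
        ≤ (ENNReal.ofReal (R i))⁻¹ * ENNReal.ofReal (M * R (i + 1) ^ s₁) :=
          mul_le_mul' le_rfl (hNle (i + 1))
      _ = ENNReal.ofReal ((R i)⁻¹ * (M * R (i + 1) ^ s₁)) := by
          rw [← ENNReal.ofReal_inv_of_pos (hR0 i), ← ENNReal.ofReal_mul (inv_nonneg.2 (hR0 i).le)]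
      _ = ENNReal.ofReal (M₁ * θ₁ ^ i + 0 * (0 : ℝ) ^ i) := by
          congr 1
          have e1 := dyadic_rpow_identity ha₀0 s₁ i
          simp only [hR, hM₁, hθ₁] at e1 ⊢
          calc (a₀ * 2 ^ i)⁻¹ * (M * (a₀ * 2 ^ (i + 1)) ^ s₁)
              = M * ((a₀ * 2 ^ i)⁻¹ * (a₀ * 2 ^ (i + 1)) ^ s₁) := by ring
            _ = M * (2 ^ s₁ * a₀ ^ (s₁ - 1)) * (2 ^ (s₁ - 1)) ^ i + 0 * (0 : ℝ) ^ i := by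
                rw [e1]; ring
  -- summing up
  have htot : ∫⁻ z in W ×ˢ (univ : Set (EuclideanSpace ℝ (Fin 3))), Ψ z < ⊤ := by
    have h1 : ∫⁻ z in W ×ˢ (univ : Set (EuclideanSpace ℝ (Fin 3))), Ψ z ≤ ∑' j, ∫⁻ z in W ×ˢ D j, Ψ z := by
      rw [← hDU]; exact lintegral_iUnion_le _ _
    have h2 : (∑' j, ∫⁻ z in W ×ˢ D j, Ψ z) = (∫⁻ z in W ×ˢ D 0, Ψ z) + ∑' i, ∫⁻ z in W ×ˢ D (i + 1), Ψ z :=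
      tsum_eq_zero_add' ENNReal.summable
    have h3 : (∑' i, ∫⁻ z in W ×ˢ D (i + 1), Ψ z) ≤ ∑' i, ENNReal.ofReal (M₁ * θ₁ ^ i + 0 * (0 : ℝ) ^ i) :=
      ENNReal.tsum_le_tsum fun i => (hshell i).trans (hterm i)
    have h4 := tsum_ofReal_geometric_two_lt_top (by positivity : 0 ≤ M₁) le_rfl hθ₁0 hθ₁1 le_rfl zero_lt_one
    have h5 : N 0 < ⊤ := lt_of_le_of_lt (hNle 0) ENNReal.ofReal_lt_top
    calc ∫⁻ z in W ×ˢ (univ : Set (EuclideanSpace ℝ (Fin 3))), Ψ z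
        ≤ (∫⁻ z in W ×ˢ D 0, Ψ z) + ∑' i, ∫⁻ z in W ×ˢ D (i + 1), Ψ z := h1.trans (le_of_eq h2)
      _ < ⊤ := ENNReal.add_lt_top.2 ⟨lt_of_le_of_lt hshell0 h5, lt_of_le_of_lt h3 h4⟩
  -- conclusion
  rw [hasFiniteIntegral_iff_enorm]
  exact lt_of_le_of_lt (lintegral_mono fun z => hGΨ z) htot

/-! ## The flux strata of the open core for `2/9 < ρ` -/

/-- **«No Euler collapse from rest», unconditionally for `2/9 < ρ`** (was `2/5 < ρ`,
`powerGaugeEulerLiouville_fromRest`): the crux VERBATIM plus rest before some time ⇒ `u ≡ 0`. [folklore] -/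
theorem powerGaugeEulerLiouville_fromRest_twoNinths :
    ∀ ρ : ℝ, 2 / 9 < ρ → ∀ (u : ℝ → EuclideanSpace ℝ (Fin 3) → EuclideanSpace ℝ (Fin 3))
      (p : ℝ → EuclideanSpace ℝ (Fin 3) → ℝ)
      (H : ℝ → EuclideanSpace ℝ (Fin 3) → EuclideanSpace ℝ (Fin 3) →L[ℝ] EuclideanSpace ℝ (Fin 3)) (c : ℝ≥0),
      IsSuitableWeakSolutionOn (slab (EuclideanSpace ℝ (Fin 3)) (Set.Iio 0) isOpen_Iio) 0 0 u p →
      HasWeakSpatialGradientOn (slab (EuclideanSpace ℝ (Fin 3)) (Set.Iio 0) isOpen_Iio) u H →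
      (∀ a : ℝ, 0 < a → ENNReal.ofReal (a ^ (2 * ρ)) * cknA a (0 : ℝ × EuclideanSpace ℝ (Fin 3)) u +
        ENNReal.ofReal (a ^ ρ) * cknE a (0 : ℝ × EuclideanSpace ℝ (Fin 3)) H +
        ENNReal.ofReal (a ^ (2 * ρ)) * cknD a (0 : ℝ × EuclideanSpace ℝ (Fin 3)) p ≤ (c : ℝ≥0∞)) →
      (∃ T : ℝ, ∀ t : ℝ, t < -T → ∀ x : EuclideanSpace ℝ (Fin 3), u t x = 0) →
      Function.uncurry u =ᵐ[volume.restrict (Set.Iio (0 : ℝ) ×ˢ (Set.univ : Set (EuclideanSpace ℝ (Fin 3))))] 0 :=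
  fun ρ hρ u p H c hsw hH hc hrest =>
    powerGaugeEulerLiouville_fromRest_of_windowFlux ρ (by linarith) u p H c hsw hH hc hrest
      fun _ _ hab hb => windowFlux_integrableOn_of_gauge_twoNinths hρ hsw hH hc hab hb

/-- **«No Euler collapse from an energy-quiescent past», unconditionally for `2/9 < ρ`** (was `2/5 < ρ`,
`powerGaugeEulerLiouville_of_energyVanishing`). [folklore] -/
theorem powerGaugeEulerLiouville_of_energyVanishing_twoNinths :
    ∀ ρ : ℝ, 2 / 9 < ρ → ∀ (u : ℝ → EuclideanSpace ℝ (Fin 3) → EuclideanSpace ℝ (Fin 3))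
      (p : ℝ → EuclideanSpace ℝ (Fin 3) → ℝ)
      (H : ℝ → EuclideanSpace ℝ (Fin 3) → EuclideanSpace ℝ (Fin 3) →L[ℝ] EuclideanSpace ℝ (Fin 3)) (c : ℝ≥0),
      IsSuitableWeakSolutionOn (slab (EuclideanSpace ℝ (Fin 3)) (Set.Iio 0) isOpen_Iio) 0 0 u p →
      HasWeakSpatialGradientOn (slab (EuclideanSpace ℝ (Fin 3)) (Set.Iio 0) isOpen_Iio) u H →
      (∀ a : ℝ, 0 < a → ENNReal.ofReal (a ^ (2 * ρ)) * cknA a (0 : ℝ × EuclideanSpace ℝ (Fin 3)) u +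
        ENNReal.ofReal (a ^ ρ) * cknE a (0 : ℝ × EuclideanSpace ℝ (Fin 3)) H +
        ENNReal.ofReal (a ^ (2 * ρ)) * cknD a (0 : ℝ × EuclideanSpace ℝ (Fin 3)) p ≤ (c : ℝ≥0∞)) →
      (∀ ε : ℝ, 0 < ε → ∀ N : ℝ,
        volume {s : ℝ | s < -N ∧ ∫⁻ x, ‖u s x‖ₑ ^ 2 ≤ ENNReal.ofReal ε} ≠ 0) →
      Function.uncurry u =ᵐ[volume.restrict (Set.Iio (0 : ℝ) ×ˢ (Set.univ : Set (EuclideanSpace ℝ (Fin 3))))] 0 :=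
  fun _ hρ _ _ _ _ hsw hH hc hvan =>
    ae_eq_zero_of_gauge_of_windowFlux_of_energyVanishing hsw hH hc
      (fun _ _ hab hb => windowFlux_integrableOn_of_gauge_twoNinths hρ hsw hH hc hab hb) hvan

/-- **No backward-tight nontrivial members, unconditionally for `2/9 < ρ`** (was `2/5 < ρ`,
`powerGaugeEulerLiouville_of_tightPast`): a nontrivial member in `2/9 < ρ ≤ 1/2` sends energy to spatial infinity
backward in time. [folklore] -/
theorem powerGaugeEulerLiouville_of_tightPast_twoNinths :
    ∀ ρ : ℝ, 2 / 9 < ρ → ∀ (u : ℝ → EuclideanSpace ℝ (Fin 3) → EuclideanSpace ℝ (Fin 3))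
      (p : ℝ → EuclideanSpace ℝ (Fin 3) → ℝ)
      (H : ℝ → EuclideanSpace ℝ (Fin 3) → EuclideanSpace ℝ (Fin 3) →L[ℝ] EuclideanSpace ℝ (Fin 3)) (c : ℝ≥0),
      IsSuitableWeakSolutionOn (slab (EuclideanSpace ℝ (Fin 3)) (Set.Iio 0) isOpen_Iio) 0 0 u p →
      HasWeakSpatialGradientOn (slab (EuclideanSpace ℝ (Fin 3)) (Set.Iio 0) isOpen_Iio) u H →
      (∀ a : ℝ, 0 < a → ENNReal.ofReal (a ^ (2 * ρ)) * cknA a (0 : ℝ × EuclideanSpace ℝ (Fin 3)) u +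
        ENNReal.ofReal (a ^ ρ) * cknE a (0 : ℝ × EuclideanSpace ℝ (Fin 3)) H +
        ENNReal.ofReal (a ^ (2 * ρ)) * cknD a (0 : ℝ × EuclideanSpace ℝ (Fin 3)) p ≤ (c : ℝ≥0∞)) →
      (∀ ε : ℝ, 0 < ε → ∃ R : ℝ, 0 < R ∧ ∃ N : ℝ, ∀ᵐ s ∂(volume : Measure ℝ), s < -N →
        ∫⁻ x in (ball (0 : EuclideanSpace ℝ (Fin 3)) R)ᶜ, ‖u s x‖ₑ ^ 2 ≤ ENNReal.ofReal ε) →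
      Function.uncurry u =ᵐ[volume.restrict (Set.Iio (0 : ℝ) ×ˢ (Set.univ : Set (EuclideanSpace ℝ (Fin 3))))] 0 :=
  fun _ hρ _ _ _ _ hsw hH hc htight =>
    ae_eq_zero_of_gauge_of_windowFlux_of_tight (by linarith) hsw hH hc
      (fun _ _ hab hb => windowFlux_integrableOn_of_gauge_twoNinths hρ hsw hH hc hab hb) htight

/-- **The global energy inequality of the class, unconditionally for `2/9 < ρ`** (was `2/5 < ρ`,
`powerGauge_energy_antitone_ae`): for a.e. `s < 0` and a.e. `t ∈ (s,0)`, `∫|u(t)|² ≤ ∫|u(s)|²`. [folklore] -/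
theorem powerGauge_energy_antitone_ae_twoNinths :
    ∀ ρ : ℝ, 2 / 9 < ρ → ∀ (u : ℝ → EuclideanSpace ℝ (Fin 3) → EuclideanSpace ℝ (Fin 3))
      (p : ℝ → EuclideanSpace ℝ (Fin 3) → ℝ)
      (H : ℝ → EuclideanSpace ℝ (Fin 3) → EuclideanSpace ℝ (Fin 3) →L[ℝ] EuclideanSpace ℝ (Fin 3)) (c : ℝ≥0),
      IsSuitableWeakSolutionOn (slab (EuclideanSpace ℝ (Fin 3)) (Set.Iio 0) isOpen_Iio) 0 0 u p →
      HasWeakSpatialGradientOn (slab (EuclideanSpace ℝ (Fin 3)) (Set.Iio 0) isOpen_Iio) u H →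
      (∀ a : ℝ, 0 < a → ENNReal.ofReal (a ^ (2 * ρ)) * cknA a (0 : ℝ × EuclideanSpace ℝ (Fin 3)) u +
        ENNReal.ofReal (a ^ ρ) * cknE a (0 : ℝ × EuclideanSpace ℝ (Fin 3)) H +
        ENNReal.ofReal (a ^ (2 * ρ)) * cknD a (0 : ℝ × EuclideanSpace ℝ (Fin 3)) p ≤ (c : ℝ≥0∞)) →
      ∀ᵐ s ∂(volume : Measure ℝ), s < 0 → ∀ᵐ t ∂(volume : Measure ℝ), t ∈ Set.Ioo s 0 →
        ∫⁻ x, ‖u t x‖ₑ ^ 2 ≤ ∫⁻ x, ‖u s x‖ₑ ^ 2 :=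
  fun _ hρ _ _ _ _ hsw hH hc =>
    lintegral_enorm_sq_antitone_ae_of_windowFlux hsw hH hc
      (fun _ _ hab hb => windowFlux_integrableOn_of_gauge_twoNinths hρ hsw hH hc hab hb)

end Summit.NavierStokesRegularity.NavierStokesRegularity.Theorems.PowerGaugeEulerLiouville

end
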